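import Mathlib
import Summits.ValiantsHypothesis.ValiantsHypothesis.Theorems.ValuativeGCTValuativeFlipDetEventualMonotone
import Summits.ValiantsHypothesis.ValiantsHypothesis.Theorems.ValuativeGCTValuativeFlipStableRay
import Summits.ValiantsHypothesis.ValiantsHypothesis.Theorems.ValuativeGCTValuativeFlipEventualInheritance
import Summits.ValiantsHypothesis.ValiantsHypothesis.Theorems.ValuativeGCTValuativeFlipTwistedInheritance
import Summits.ValiantsHypothesis.ValiantsHypothesis.Theorems.ValuativeGCTNoValuativeFlipBeyondGrenet
import Summits.ValiantsHypothesis.ValiantsHypothesis.Theorems.ValuativeGCTValuativeFlipInnerMonotone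
import HarnessLib

/-!
# `ValuativeGCT.ValuativeFlip` (stmt-ValiantsHypothesis-12624): RAY STABILITY — representation
# stability of both sides of the flip along Kadish–Landsberg row lifts `μ ↦ μ♯(n+j)`

Crux `ValuativeFlip` of route `ValuativeGCT`; wall-breaker decomposition k16/16, axis
"representation-stability transfer between `m` and `m + 1`" (second gen-1 seat, 2026-08-16).

Letters: inner size `n ≥ 1`, degree `δ`, inner shape `μ ⊢ n·δ` with at most `n²` parts, padding
`j`, level `m = n + j`, row lift `μ♯(n+j) = μ + (jδ)` (`rowLift μ j`), and along the ray
* `K(j) := K_{n+j}((μ♯(n+j))*) = mult ℂ[Δ(det_{n+j})]` (`orbitMultiplicity ℂ (detFormLex ℂ (n+j)) …`),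
* `P(j) := mult_{(μ♯(n+j))*} ℂ[Δ_{n+j}(X₀₀^j per_n)]` (`orbitMultiplicity ℂ (paddedPerFormLex ℂ n (n+j)) …`),
* `g(j) := g(μ♯(n+j), (n+j)×δ, (n+j)×δ)` (`kroneckerCoeff`).

What the earlier seats of this axis proved is MONOTONICITY, eventually in `j`: `K(j₁) ≤ K(j)` for
`j ≥ J(j₁)` (`det_eventualMonotone`, k16 gen 1), `P(0) ≤ P(j)` for `j ≥ j₀`
(`eventualInheritance_of_twistedInheritance` + `stub_twistedInheritance`, k4/k12), and Manivel's
`g(j+1) ≤ g(j)` once `|μ̄| ≤ n + j` (`kroneckerCoeff_rowLift_succ_le`, Literature).  This file turns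
monotonicity into STABILITY — genuine representation stability in the sense of eventually constant
multiplicities — and draws the consequence for the flip:

1. `nat_eventuallyConst_of_eventually_le_of_bdd` — an `ℕ`-valued sequence that eventually dominates
   each of its values and is eventually bounded is eventually CONSTANT, equal to its maximum.
2. `det_rayStable` — **`K(j)` is eventually constant**, `=: K∞(μ)`, and `K(j) ≤ K∞(μ)` for EVERY `j`
   (eventual domination from every start of the ray + the Kronecker bound of `…StableRay` beyond the
   body threshold `j ≥ |μ̄|`).  In particular `K_n(μ*) ≤ K∞(μ)` (`det_base_le_rayLimit`).
3. `kronecker_rayStable` — `g(j)` is eventually constant `=: g∞(μ)` and `K∞(μ) ≤ g∞(μ)`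
   (`det_rayLimit_le_kronecker_rayLimit`).
4. `per_bottom_le_det_rayLimit`, **`stableDet_dominates_bottom`** — the CATCH-UP INEQUALITY
   `max(P_n(μ), K_n(μ*)) ≤ K∞(μ)` and `P(j) ≤ K∞(μ)` for all large `j`: the stable determinantal
   multiplicity of every inner shape dominates the permanent's own multiplicity at the bottom of the
   window — although at the bottom itself `K_n(μ*) < P_n(μ)` does happen (the bottom window flips,
   `ValuativeGCTValuativeFlipBottomWindow`).  Along every Kadish–Landsberg ray the determinant side
   therefore starts possibly BELOW and ends ABOVE the permanent's value: the crux `ValuativeFlip`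
   lives entirely in the transient of the ray, before stabilisation — the quantitative form of the
   axis verdict "every `m → m+1` transfer is co-monotone" (AXIS k16).

Everything is unconditional and rests on accepted tree theorems only.
[BLMW 2011 §6.4 Problem 6.10; Ikenmeyer–Panova 2017 Thm. 2.1, Prop. 2.8; Manivel 2011 Thm. 1;
Church–Ellenberg–Farb 2015 (representation stability, the notion); this crux's
`…DetEventualMonotone`, `…StableRay`, `…EventualInheritance`, `…TwistedInheritance`,
`…NoValuativeFlipBeyondGrenet`, `…InnerMonotone`]
-/

set_option linter.dupNamespace false

namespace Summit.ValiantsHypothesis.ValiantsHypothesis.Theorems.ValuativeFlip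

open Literature.NumberTheory.DiophantineGeometry
open Literature.Computability.AlgebraicComplexity
open Literature.Computability.Complexity
open Summit.ValiantsHypothesis.ValiantsHypothesis.Theorems.NoValuativeFlip

noncomputable section

/-! ## §1 Abstract stabilisation of `ℕ`-valued sequences -/

/-- **Eventual domination + eventual boundedness ⇒ eventual constancy.**  If `f : ℕ → ℕ`
eventually dominates each of its values (`∀ j₁, f j₁ ≤ f j` for all large `j`) and is eventually
bounded, then `f` is eventually constant, equal to its maximum value `L`, and `f j ≤ L` for every `j`.
(The maximum of the bounded range is attained at some `j⋆`; beyond the domination threshold of `j⋆`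
every value is squeezed between `f j⋆ = L` and `L`.) [folklore] -/
theorem nat_eventuallyConst_of_eventually_le_of_bdd (f : ℕ → ℕ)
    (hdom : ∀ j₁ : ℕ, ∃ J : ℕ, ∀ j : ℕ, J ≤ j → f j₁ ≤ f j)
    (hbdd : ∃ B J : ℕ, ∀ j : ℕ, J ≤ j → f j ≤ B) :
    ∃ j₀ L : ℕ, (∀ j : ℕ, j₀ ≤ j → f j = L) ∧ (∀ j : ℕ, f j ≤ L) := by
  obtain ⟨B, J, hB⟩ := hbdd
  have hall : ∀ j, f j ≤ B := by
    intro j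
    obtain ⟨J', hJ'⟩ := hdom j
    exact (hJ' (max J J') (le_max_right _ _)).trans (hB _ (le_max_left _ _))
  have hbdd' : BddAbove (Set.range f) := ⟨B, by rintro _ ⟨j, rfl⟩; exact hall j⟩
  have hne : (Set.range f).Nonempty := ⟨f 0, 0, rfl⟩
  obtain ⟨jstar, hjstar⟩ : sSup (Set.range f) ∈ Set.range f := Nat.sSup_mem hne hbdd'
  obtain ⟨J₀, hJ₀⟩ := hdom jstar
  refine ⟨J₀, f jstar, fun j hj => le_antisymm ?_ (hJ₀ j hj), fun j => ?_⟩
  · rw [hjstar]; exact le_csSup hbdd' ⟨j, rfl⟩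
  · rw [hjstar]; exact le_csSup hbdd' ⟨j, rfl⟩

/-- **A sequence that is non-increasing from `J` on is eventually constant**, equal to its minimum
`L` over `j ≥ J`, and `L ≤ g j` for every `j ≥ J`. [folklore] -/
theorem nat_eventuallyConst_of_antitone_from (g : ℕ → ℕ) (J : ℕ)
    (hstep : ∀ j : ℕ, J ≤ j → g (j + 1) ≤ g j) :
    ∃ j₀ L : ℕ, J ≤ j₀ ∧ (∀ j : ℕ, j₀ ≤ j → g j = L) ∧ (∀ j : ℕ, J ≤ j → L ≤ g j) := by
  have hanti : ∀ a b : ℕ, J ≤ a → a ≤ b → g b ≤ g a := by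
    intro a b ha hab
    induction b, hab using Nat.le_induction with
    | base => exact le_rfl
    | succ b hab ih => exact (hstep b (ha.trans hab)).trans ih
  set S : Set ℕ := g '' {j | J ≤ j} with hS
  have hne : S.Nonempty := ⟨g J, J, show J ≤ J from le_rfl, rfl⟩
  obtain ⟨jstar, hJj, hjstar⟩ : sInf S ∈ S := Nat.sInf_mem hne
  refine ⟨jstar, g jstar, hJj, fun j hj => le_antisymm (hanti jstar j hJj hj) ?_, fun j hj => ?_⟩
  · rw [hjstar]; exact Nat.sInf_le ⟨j, hJj.trans hj, rfl⟩
  · rw [hjstar]; exact Nat.sInf_le ⟨j, hj, rfl⟩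

/-! ## §2 Bookkeeping: levels `n + j₁ + j' = n + (j₁ + j')` and iterated row lifts -/

/-- Transport of `K_m(λ*)` along an equality of levels and of parts (the level `m` enters the TYPE of
`detFormLex ℂ m`, so `(n + j₁) + j'` and `n + (j₁ + j')` must be identified by hand). [folklore] -/
theorem orbitMultiplicity_det_congr_level {m₁ m₂ : ℕ} (h : m₁ = m₂) {D₁ D₂ : ℕ}
    (lam₁ : Nat.Partition D₁) (lam₂ : Nat.Partition D₂) (hp : lam₁.parts = lam₂.parts) :
    orbitMultiplicity ℂ (detFormLex ℂ m₁) m₁ (partitionWeightLex m₁ lam₁) =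
      orbitMultiplicity ℂ (detFormLex ℂ m₂) m₂ (partitionWeightLex m₂ lam₂) := by
  subst h
  have hD : D₁ = D₂ := by rw [← lam₁.parts_sum, ← lam₂.parts_sum, hp]
  subst hD
  obtain rfl : lam₁ = lam₂ := Nat.Partition.ext hp
  rfl

/-- The same transport for the padded permanent `X₀₀^{m-n} per_n` at level `m`. [folklore] -/
theorem orbitMultiplicity_paddedPer_congr_level {n m₁ m₂ : ℕ} (h : m₁ = m₂) [NeZero m₁] [NeZero m₂]
    {D₁ D₂ : ℕ} (lam₁ : Nat.Partition D₁) (lam₂ : Nat.Partition D₂) (hp : lam₁.parts = lam₂.parts) :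
    orbitMultiplicity ℂ (paddedPerFormLex ℂ n m₁) m₁ (partitionWeightLex m₁ lam₁) =
      orbitMultiplicity ℂ (paddedPerFormLex ℂ n m₂) m₂ (partitionWeightLex m₂ lam₂) := by
  subst h
  have hD : D₁ = D₂ := by rw [← lam₁.parts_sum, ← lam₂.parts_sum, hp]
  subst hD
  obtain rfl : lam₁ = lam₂ := Nat.Partition.ext hp
  rfl

/-- Transport of the rectangular Kronecker coefficient `g(λ, m×δ, m×δ)` along an equality of levels
and of parts. [folklore] -/
theorem kroneckerCoeff_rectangle_congr_level {m₁ m₂ δ : ℕ} (h : m₁ = m₂)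
    (lam₁ : Nat.Partition (m₁ * δ)) (lam₂ : Nat.Partition (m₂ * δ)) (hp : lam₁.parts = lam₂.parts) :
    kroneckerCoeff ℂ lam₁ (Nat.Partition.rectangle m₁ δ) (Nat.Partition.rectangle m₁ δ) =
      kroneckerCoeff ℂ lam₂ (Nat.Partition.rectangle m₂ δ) (Nat.Partition.rectangle m₂ δ) := by
  subst h
  obtain rfl : lam₁ = lam₂ := Nat.Partition.ext hp
  rfl

/-- `λ♯` keeps the number of parts below the square of the new level: `ℓ(μ♯(n+j)) ≤ (n+j)²` for
`ℓ(μ) ≤ n²`, `n ≥ 1`. [folklore] -/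
theorem card_parts_rowLift_le_sq {n δ : ℕ} [NeZero n] (μ : Nat.Partition (n * δ))
    (hμ : μ.parts.card ≤ n * n) (j : ℕ) :
    (rowLift μ j).parts.card ≤ (n + j) * (n + j) :=
  (card_parts_rowLift_le μ j).trans (max_le (hμ.trans (Nat.mul_le_mul (Nat.le_add_right n j)
    (Nat.le_add_right n j))) (Nat.one_le_iff_ne_zero.2 (mul_ne_zero (by have := NeZero.ne n; omega)
      (by have := NeZero.ne n; omega))))

/-- **Row lifts compose**: `(μ♯(n+a))♯(n+a+b)` and `μ♯(n+(a+b))` have the same parts. [folklore] -/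
theorem parts_rowLift_rowLift {n δ : ℕ} (μ : Nat.Partition (n * δ)) (a b : ℕ) :
    (rowLift (rowLift μ a) b).parts = (rowLift μ (a + b)).parts := by
  haveI : NeZero (μ.parts.card + 1) := ⟨Nat.succ_ne_zero _⟩
  have hc1 : (rowLift (rowLift μ a) b).parts.card ≤ μ.parts.card + 1 :=
    (card_parts_rowLift_le _ b).trans (max_le ((card_parts_rowLift_le μ a).trans
      (max_le (Nat.le_succ _) (by omega))) (by omega))
  have hc2 : (rowLift μ (a + b)).parts.card ≤ μ.parts.card + 1 :=
    (card_parts_rowLift_le μ (a + b)).trans (max_le (Nat.le_succ _) (by omega))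
  refine parts_eq_of_ofPartition_eq (N := μ.parts.card + 1) ?_ hc1 hc2
  rw [ofPartition_rowLift, ofPartition_rowLift, ofPartition_rowLift, add_assoc, ← Pi.single_add]
  congr 2
  push_cast
  ring

/-! ## §3 The determinant side: `K_{n+j}((μ♯)*)` is eventually constant -/

/-- **Eventual domination from every start of the ray.**  For every `j₁` there is `J` with
`K_{n+j₁}((μ♯(n+j₁))*) ≤ K_{n+j}((μ♯(n+j))*)` for all `j ≥ J`: `det_eventualMonotone` applied at the
level `n + j₁` to the shape `μ♯(n+j₁)`, whose row lifts are those of `μ` (`parts_rowLift_rowLift`).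
[BLMW 2011 Problem 6.10 (det half, eventual); this crux's `det_eventualMonotone`] -/
theorem det_ray_eventually_ge (n δ : ℕ) [NeZero n] (μ : Nat.Partition (n * δ))
    (hμ : μ.parts.card ≤ n * n) (j₁ : ℕ) :
    ∃ J : ℕ, ∀ j : ℕ, J ≤ j →
      orbitMultiplicity ℂ (detFormLex ℂ (n + j₁)) (n + j₁) (partitionWeightLex (n + j₁) (rowLift μ j₁)) ≤
        orbitMultiplicity ℂ (detFormLex ℂ (n + j)) (n + j) (partitionWeightLex (n + j) (rowLift μ j)) := by
  haveI : NeZero (n + j₁) := ⟨by have := NeZero.ne n; omega⟩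
  obtain ⟨j₀, hj₀⟩ := det_eventualMonotone (n + j₁) δ (rowLift μ j₁) (card_parts_rowLift_le_sq μ hμ j₁)
  refine ⟨j₁ + j₀, fun j hj => ?_⟩
  obtain ⟨j', rfl⟩ : ∃ j', j = j₁ + j' := ⟨j - j₁, by omega⟩
  haveI : NeZero (n + j₁ + j') := ⟨by have := NeZero.ne n; omega⟩
  have h := hj₀ j' (by omega)
  rwa [orbitMultiplicity_det_congr_level (show n + j₁ + j' = n + (j₁ + j') by ring)
    (rowLift (rowLift μ j₁) j') (rowLift μ (j₁ + j')) (parts_rowLift_rowLift μ j₁ j')] at h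

/-- **Eventual boundedness of the ray.**  Beyond the body threshold `j ≥ |μ̄|` the shape `μ♯(n+j)` is
Manivel-stable (`|μ̄| ≤ n + j`), so `K_{n+j}((μ♯)*) ≤ g(μ♯(n+J), (n+J)×δ, (n+J)×δ)` with `J = |μ̄|`
for every `j ≥ J` (`orbitMultiplicity_det_rowLift_le_kroneckerCoeff` of `…StableRay` at base `n + J`).
[Ikenmeyer–Panova 2017 Thm. 2.1; Manivel 2011 Thm. 1; BLMW 2011 Prop. 5.2.1] -/
theorem det_ray_bdd (n δ : ℕ) [NeZero n] (μ : Nat.Partition (n * δ)) (hμ : μ.parts.card ≤ n * n) :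
    ∃ B J : ℕ, ∀ j : ℕ, J ≤ j →
      orbitMultiplicity ℂ (detFormLex ℂ (n + j)) (n + j) (partitionWeightLex (n + j) (rowLift μ j)) ≤ B := by
  set J := bodySize μ with hJ
  haveI : NeZero (n + J) := ⟨by have := NeZero.ne n; omega⟩
  have hbody : bodySize (rowLift μ J) ≤ n + J := by rw [bodySize_rowLift]; omega
  refine ⟨kroneckerCoeff ℂ (rowLift μ J) (Nat.Partition.rectangle (n + J) δ) (Nat.Partition.rectangle (n + J) δ),
    J, fun j hj => ?_⟩
  obtain ⟨j', rfl⟩ : ∃ j', j = J + j' := ⟨j - J, by omega⟩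
  have h := orbitMultiplicity_det_rowLift_le_kroneckerCoeff (rowLift μ J) (card_parts_rowLift_le_sq μ hμ J) hbody j'
  rwa [orbitMultiplicity_det_congr_level (show n + J + j' = n + (J + j') by ring)
    (rowLift (rowLift μ J) j') (rowLift μ (J + j')) (parts_rowLift_rowLift μ J j')] at h

/-- **RAY STABILITY OF THE DETERMINANT (representation stability of `Δ(det_m)` along row lifts).**
For every inner size `n ≥ 1`, degree `δ` and shape `μ ⊢ n·δ` with at most `n²` parts, the
multiplicity `K_{n+j}((μ♯(n+j))*)` of the row-lifted shape in `ℂ[Δ(det_{n+j})]` is EVENTUALLY CONSTANT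
in the padding `j` — call the stable value `K∞(μ)` — and `K_{n+j}((μ♯(n+j))*) ≤ K∞(μ)` for every `j`:
`K∞(μ)` is the maximum over the ray.  (Eventual domination from every start, `det_ray_eventually_ge`,
+ eventual boundedness, `det_ray_bdd`, + `nat_eventuallyConst_of_eventually_le_of_bdd`.)  The
monotone half `K(j₁) ≤ K(j)` for `j ≫ j₁` was BLMW's Problem 6.10 in eventual form; constancy is the
stability statement proper. [BLMW 2011 §6.4; Ikenmeyer–Panova 2017 §2; this file] -/
theorem det_rayStable (n δ : ℕ) [NeZero n] (μ : Nat.Partition (n * δ)) (hμ : μ.parts.card ≤ n * n) :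
    ∃ j₀ K : ℕ,
      (∀ j : ℕ, j₀ ≤ j →
        orbitMultiplicity ℂ (detFormLex ℂ (n + j)) (n + j) (partitionWeightLex (n + j) (rowLift μ j)) = K) ∧
      (∀ j : ℕ,
        orbitMultiplicity ℂ (detFormLex ℂ (n + j)) (n + j) (partitionWeightLex (n + j) (rowLift μ j)) ≤ K) :=
  nat_eventuallyConst_of_eventually_le_of_bdd _ (det_ray_eventually_ge n δ μ hμ) (det_ray_bdd n δ μ hμ)

/-- The stable value is unique: two eventual values of the ray coincide. [folklore] -/
theorem det_rayLimit_unique (n δ : ℕ) (μ : Nat.Partition (n * δ)) {K K' : ℕ}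
    (hK : ∃ j₀ : ℕ, ∀ j : ℕ, j₀ ≤ j →
      orbitMultiplicity ℂ (detFormLex ℂ (n + j)) (n + j) (partitionWeightLex (n + j) (rowLift μ j)) = K)
    (hK' : ∃ j₀ : ℕ, ∀ j : ℕ, j₀ ≤ j →
      orbitMultiplicity ℂ (detFormLex ℂ (n + j)) (n + j) (partitionWeightLex (n + j) (rowLift μ j)) = K') :
    K = K' := by
  obtain ⟨j₀, hj₀⟩ := hK
  obtain ⟨j₀', hj₀'⟩ := hK'
  rw [← hj₀ (max j₀ j₀') (le_max_left _ _), ← hj₀' (max j₀ j₀') (le_max_right _ _)]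

/-- **The base of the ray is dominated by the stable value**: `K_n(μ*) ≤ K∞(μ)` for any eventual
value `K∞(μ)` of the ray (the case `j = 0` of `det_rayStable`, `μ♯(n+0) = μ`). [this file] -/
theorem det_base_le_rayLimit (n δ : ℕ) [NeZero n] (μ : Nat.Partition (n * δ)) (hμ : μ.parts.card ≤ n * n)
    {K : ℕ} (hK : ∃ j₀ : ℕ, ∀ j : ℕ, j₀ ≤ j →
      orbitMultiplicity ℂ (detFormLex ℂ (n + j)) (n + j) (partitionWeightLex (n + j) (rowLift μ j)) = K) :
    orbitMultiplicity ℂ (detFormLex ℂ n) n (partitionWeightLex n μ) ≤ K := by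
  obtain ⟨j₀, K₀, hK₀, hle⟩ := det_rayStable n δ μ hμ
  have hKK : K₀ = K := det_rayLimit_unique n δ μ ⟨j₀, hK₀⟩ hK
  rw [← hKK, orbitMultiplicity_det_congr_level (show n = n + 0 by ring) μ (rowLift μ 0) (parts_rowLift_zero μ).symm]
  exact hle 0

/-- **Every value along the ray is dominated by the stable value** (restatement of the second clause
of `det_rayStable` for an arbitrary eventual value). [this file] -/
theorem det_ray_le_rayLimit (n δ : ℕ) [NeZero n] (μ : Nat.Partition (n * δ)) (hμ : μ.parts.card ≤ n * n)
    {K : ℕ} (hK : ∃ j₀ : ℕ, ∀ j : ℕ, j₀ ≤ j →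
      orbitMultiplicity ℂ (detFormLex ℂ (n + j)) (n + j) (partitionWeightLex (n + j) (rowLift μ j)) = K)
    (j : ℕ) :
    orbitMultiplicity ℂ (detFormLex ℂ (n + j)) (n + j) (partitionWeightLex (n + j) (rowLift μ j)) ≤ K := by
  obtain ⟨j₀, K₀, hK₀, hle⟩ := det_rayStable n δ μ hμ
  have hKK : K₀ = K := det_rayLimit_unique n δ μ ⟨j₀, hK₀⟩ hK
  rw [← hKK]
  exact hle j

/-! ## §4 The Kronecker majorant: `g(μ♯(n+j), (n+j)×δ, (n+j)×δ)` is eventually constant -/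

/-- **One Manivel step anywhere beyond the body threshold**: for `|μ̄| ≤ n + j`,
`g(μ♯(n+j+1), (n+j+1)×δ, (n+j+1)×δ) ≤ g(μ♯(n+j), (n+j)×δ, (n+j)×δ)` (`kroneckerCoeff_rowLift_succ_le` at
base `n + j`, shape `μ♯(n+j)`, zero further steps, transported by `parts_rowLift_rowLift`).
[Manivel 2011 Thm. 1; Ikenmeyer–Panova 2017 Thm. 2.1] -/
theorem kronecker_ray_step (n δ : ℕ) (μ : Nat.Partition (n * δ)) (j : ℕ) (hj : bodySize μ ≤ n + j) :
    kroneckerCoeff ℂ (rowLift μ (j + 1)) (Nat.Partition.rectangle (n + (j + 1)) δ)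
        (Nat.Partition.rectangle (n + (j + 1)) δ) ≤
      kroneckerCoeff ℂ (rowLift μ j) (Nat.Partition.rectangle (n + j) δ) (Nat.Partition.rectangle (n + j) δ) := by
  have hbody : bodySize (rowLift μ j) ≤ n + j := by rw [bodySize_rowLift]; exact hj
  have h := kroneckerCoeff_rowLift_succ_le (rowLift μ j) hbody 0
  rw [kroneckerCoeff_rectangle_congr_level (show n + j + (0 + 1) = n + (j + 1) by ring)
      (rowLift (rowLift μ j) (0 + 1)) (rowLift μ (j + 1)) (parts_rowLift_rowLift μ j (0 + 1)),
    kroneckerCoeff_rectangle_congr_level (show n + j + 0 = n + j by ring)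
      (rowLift (rowLift μ j) 0) (rowLift μ j) ((parts_rowLift_rowLift μ j 0).trans
        (congrArg (fun x => (rowLift μ x).parts) (Nat.add_zero j)))] at h
  exact h

/-- **RAY STABILITY OF THE KRONECKER MAJORANT.**  `g(μ♯(n+j), (n+j)×δ, (n+j)×δ)` is non-increasing
from `j = |μ̄|` on (Manivel), hence eventually constant `=: g∞(μ)`, and `g∞(μ) ≤ g(μ♯(n+j), …)` for
every `j ≥ |μ̄|`.  (For `|μ̄| ≤ n` this is IP17's stable range from the start of the ray.)
[Manivel 2011 Thm. 1; Ikenmeyer–Panova 2017 Thm. 2.1; Vallejo 1999 (stability of Kronecker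
coefficients)] -/
theorem kronecker_rayStable (n δ : ℕ) (μ : Nat.Partition (n * δ)) :
    ∃ j₀ G : ℕ, bodySize μ ≤ n + j₀ ∧
      (∀ j : ℕ, j₀ ≤ j →
        kroneckerCoeff ℂ (rowLift μ j) (Nat.Partition.rectangle (n + j) δ) (Nat.Partition.rectangle (n + j) δ) = G) ∧
      (∀ j : ℕ, bodySize μ ≤ n + j →
        G ≤ kroneckerCoeff ℂ (rowLift μ j) (Nat.Partition.rectangle (n + j) δ) (Nat.Partition.rectangle (n + j) δ)) := by
  obtain ⟨j₀, G, hJ, hconst, hmin⟩ := nat_eventuallyConst_of_antitone_from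
    (fun j => kroneckerCoeff ℂ (rowLift μ j) (Nat.Partition.rectangle (n + j) δ) (Nat.Partition.rectangle (n + j) δ))
    (bodySize μ - n) (fun j hj => kronecker_ray_step n δ μ j (by omega))
  exact ⟨j₀, G, by omega, hconst, fun j hj => hmin j (by omega)⟩

/-- **`K∞(μ) ≤ g∞(μ)`**: the stable determinantal multiplicity is at most the stable Kronecker
coefficient (BLMW Prop. 5.2.1 `K_m(λ*) ≤ g(λ, m×δ, m×δ)` at every level, passed to the limits).
[BLMW 2011 Prop. 5.2.1; this file] -/
theorem det_rayLimit_le_kronecker_rayLimit (n δ : ℕ) [NeZero n] (μ : Nat.Partition (n * δ))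
    (hμ : μ.parts.card ≤ n * n) {K G : ℕ}
    (hK : ∃ j₀ : ℕ, ∀ j : ℕ, j₀ ≤ j →
      orbitMultiplicity ℂ (detFormLex ℂ (n + j)) (n + j) (partitionWeightLex (n + j) (rowLift μ j)) = K)
    (hG : ∃ j₀ : ℕ, ∀ j : ℕ, j₀ ≤ j →
      kroneckerCoeff ℂ (rowLift μ j) (Nat.Partition.rectangle (n + j) δ) (Nat.Partition.rectangle (n + j) δ) = G) :
    K ≤ G := by
  obtain ⟨j₀, hj₀⟩ := hK
  obtain ⟨j₀', hj₀'⟩ := hG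
  set j := max j₀ j₀' with hj
  rw [← hj₀ j (le_max_left _ _), ← hj₀' j (le_max_right _ _)]
  exact orbitMultiplicity_det_le_kroneckerCoeff_holds (k := ℂ) (rowLift μ j) (card_parts_rowLift_le_sq μ hμ j)

/-! ## §5 The permanent side against the stable determinant: the catch-up inequality -/

/-- **The tail of the permanent's ray is dominated by `K∞(μ)`**: for all large `j`,
`mult_{(μ♯(n+j))*} ℂ[Δ_{n+j}(X₀₀^j per_n)] ≤ K∞(μ)` — beyond Grenet's bound `2ⁿ ≤ n + j + 1` the padded
permanent lies in `Δ(det_{n+j})` (`orbitMultiplicity_paddedPer_le_det_of_two_pow_le`), and `K` has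
stabilised. [Grenet 2011; BLMW 2011 §1; this file] -/
theorem per_ray_le_det_rayLimit (n δ : ℕ) [NeZero n] (μ : Nat.Partition (n * δ))
    {K : ℕ} (hK : ∃ j₀ : ℕ, ∀ j : ℕ, j₀ ≤ j →
      orbitMultiplicity ℂ (detFormLex ℂ (n + j)) (n + j) (partitionWeightLex (n + j) (rowLift μ j)) = K) :
    ∃ j₂ : ℕ, ∀ j : ℕ, j₂ ≤ j → ∀ [NeZero (n + j)],
      orbitMultiplicity ℂ (paddedPerFormLex ℂ n (n + j)) (n + j) (partitionWeightLex (n + j) (rowLift μ j)) ≤ K := by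
  obtain ⟨j₀, hj₀⟩ := hK
  refine ⟨max j₀ (2 ^ n), fun j hj _ => ?_⟩
  have h2 : 2 ^ n ≤ n + j + 1 := by
    have := le_of_max_le_right hj
    omega
  calc orbitMultiplicity ℂ (paddedPerFormLex ℂ n (n + j)) (n + j) (partitionWeightLex (n + j) (rowLift μ j))
      ≤ orbitMultiplicity ℂ (detFormLex ℂ (n + j)) (n + j) (partitionWeightLex (n + j) (rowLift μ j)) :=
        orbitMultiplicity_paddedPer_le_det_of_two_pow_le h2 _
    _ = K := hj₀ j (le_of_max_le_left hj)

/-- **THE CATCH-UP INEQUALITY `P_n(μ) ≤ K∞(μ)`.**  The multiplicity of `μ*` in the coordinate ring of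
the orbit closure of the permanent `per_n` ITSELF is at most the stable determinantal multiplicity of
the ray of `μ`: eventual inheritance `P_n(μ) ≤ mult_{(μ♯)*} ℂ[Δ_{n+j}(X₀₀^j per_n)]` (`j ≫ 0`,
`eventualInheritance_of_twistedInheritance` with the landed `stub_twistedInheritance`), then
`per_ray_le_det_rayLimit`.  Contrast: at the base of the ray `K_n(μ*) < P_n(μ)` does occur (the bottom
of every window flips, `ValuativeGCTValuativeFlipBottomWindow`), so along such a ray the determinant
side starts below and stabilises above the permanent's value. [BLMW 2011 §6.4; this file] -/
theorem per_bottom_le_det_rayLimit (n δ : ℕ) [NeZero n] (μ : Nat.Partition (n * δ))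
    (hμ : μ.parts.card ≤ n * n) {K : ℕ}
    (hK : ∃ j₀ : ℕ, ∀ j : ℕ, j₀ ≤ j →
      orbitMultiplicity ℂ (detFormLex ℂ (n + j)) (n + j) (partitionWeightLex (n + j) (rowLift μ j)) = K) :
    orbitMultiplicity ℂ (paddedPerFormLex ℂ n n) n (partitionWeightLex n μ) ≤ K := by
  obtain ⟨j₁, hj₁⟩ := eventualInheritance_of_twistedInheritance stub_twistedInheritance n δ μ hμ
  obtain ⟨j₂, hj₂⟩ := per_ray_le_det_rayLimit n δ μ hK
  set j := max j₁ j₂ with hj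
  haveI : NeZero (n + j) := ⟨by have := NeZero.ne n; omega⟩
  exact (hj₁ j (le_max_left _ _)).trans (hj₂ j (le_max_right _ _))

/-- **Every inner size below `n` as well**: `mult_{μ*} ℂ[Δ_n(X₀₀^{n-n'} per_{n'})] ≤ K∞(μ)` for all
`n' ≤ n` (inner monotonicity `orbitMultiplicity_paddedPer_le_per`, then the catch-up inequality).
[this crux's `…InnerMonotone`; this file] -/
theorem paddedPer_base_le_det_rayLimit (n δ : ℕ) [NeZero n] (μ : Nat.Partition (n * δ))
    (hμ : μ.parts.card ≤ n * n) {n' : ℕ} (hn' : n' ≤ n) {K : ℕ}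
    (hK : ∃ j₀ : ℕ, ∀ j : ℕ, j₀ ≤ j →
      orbitMultiplicity ℂ (detFormLex ℂ (n + j)) (n + j) (partitionWeightLex (n + j) (rowLift μ j)) = K) :
    orbitMultiplicity ℂ (paddedPerFormLex ℂ n' n) n (partitionWeightLex n μ) ≤ K :=
  (orbitMultiplicity_paddedPer_le_per hn' _).trans (per_bottom_le_det_rayLimit n δ μ hμ hK)

/-- **STABLE DETERMINANTAL MULTIPLICITIES DOMINATE THE BOTTOM OF THE WINDOW (summary).**  For every
`n ≥ 1`, `δ`, `μ ⊢ n·δ` with at most `n²` parts there are `j₀` and `K∞` such that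
(i) `K_{n+j}((μ♯(n+j))*) = K∞` for all `j ≥ j₀` (ray stability), (ii) `K_{n+j}((μ♯(n+j))*) ≤ K∞` for
all `j`, in particular `K_n(μ*) ≤ K∞`, (iii) `P_n(μ) = mult_{μ*} ℂ[Δ_n(per_n)] ≤ K∞` (catch-up), and
(iv) `mult_{(μ♯)*} ℂ[Δ_{n+j}(X₀₀^j per_n)] ≤ K∞` for all `j ≥ j₀`.  So a multiplicity flip on the ray of
`μ` — per side above det side — can only occur in the TRANSIENT `j < j₀(μ)`: the `m → m + 1`
transfers of the axis are co-monotone and the det side always catches up. [this file] -/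
theorem stableDet_dominates_bottom (n δ : ℕ) [NeZero n] (μ : Nat.Partition (n * δ))
    (hμ : μ.parts.card ≤ n * n) :
    ∃ j₀ K : ℕ,
      (∀ j : ℕ, j₀ ≤ j →
        orbitMultiplicity ℂ (detFormLex ℂ (n + j)) (n + j) (partitionWeightLex (n + j) (rowLift μ j)) = K) ∧
      (∀ j : ℕ,
        orbitMultiplicity ℂ (detFormLex ℂ (n + j)) (n + j) (partitionWeightLex (n + j) (rowLift μ j)) ≤ K) ∧
      orbitMultiplicity ℂ (detFormLex ℂ n) n (partitionWeightLex n μ) ≤ K ∧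
      orbitMultiplicity ℂ (paddedPerFormLex ℂ n n) n (partitionWeightLex n μ) ≤ K ∧
      (∀ j : ℕ, j₀ ≤ j → ∀ [NeZero (n + j)],
        orbitMultiplicity ℂ (paddedPerFormLex ℂ n (n + j)) (n + j) (partitionWeightLex (n + j) (rowLift μ j)) ≤ K) := by
  obtain ⟨j₀, K, hK, hle⟩ := det_rayStable n δ μ hμ
  obtain ⟨j₂, hj₂⟩ := per_ray_le_det_rayLimit n δ μ ⟨j₀, hK⟩
  refine ⟨max j₀ j₂, K, fun j hj => hK j (le_of_max_le_left hj), hle,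
    det_base_le_rayLimit n δ μ hμ ⟨j₀, hK⟩, per_bottom_le_det_rayLimit n δ μ hμ ⟨j₀, hK⟩,
    fun j hj _ => hj₂ j (le_of_max_le_right hj)⟩

end

end Summit.ValiantsHypothesis.ValiantsHypothesis.Theorems.ValuativeFlip
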